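import Summits.RiemannHypothesis.RiemannHypothesis.Theorems.NymanBeurlingNbThesis
import Summits.RiemannHypothesis.RiemannHypothesis.Theorems.NymanBeurlingNbThesisLowerBound
import Summits.RiemannHypothesis.RiemannHypothesis.Theorems.NymanBeurlingNbThesisIntegrable
import Summits.RiemannHypothesis.RiemannHypothesis.Theorems.NymanBeurlingNbRateLogNumeric
import HarnessLib

/-!
# Costume detectors VI (NB-NEG: the NB criterion is a tail event in the level; REFUTED over-strengthened NB tails) —
# cell `rh-split`; raw quantified forms, ZERO defs; typed by rh-split-nb-neg g2, filed by rh-split-typer-1, refereed by rh-split-ref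

Companion of `CostumeDetectorsNb.lean` (witness/lens tail, θ = ∞ tail).

Family nb (Nyman–Beurling / Báez-Duarte), lens NEG (cheap refutations of tail conjuncts), card
`run/shared/lean/pub/rh-split/cards/SPLIT-nb-neg.md`.  `E_NB = Theses.NymanBeurling.NbThesis`
(`∀ ε > 0, ∃ N a, I(N,a) < ε`, `I(N,a) = ∫⁻ ‖1 - ζ(1/2+it)·Σ_{k<N} a_k (k+1)^{-(1/2+it)}‖² dt/(1/4+t²)
= 2π d_N(a)²`), kernel `Theorems.nbThesis_iff_riemannHypothesis`.  Raw (definition-free) forms of the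
seat's scratch theorems (`HOME/rh-split-nb-neg/Sketch.lean`, ns `RHSplit.NbNeg`):

* `nb_levelTail_iff_rh` — the criterion is a TAIL EVENT in the level: for every `H`,
  `(∀ ε>0, ∃ N ≥ H, ∃ a, I(N,a) < ε) ↔ RH` (zero-padding; F1-free, no verified zeros needed).
* `not_nb_rateTail_of_le` — REFUTED over-strengthened tail: `∀ N ≥ H, ∃ a, I(N,a) ≤ C/log N` is false
  for every `C ≤ 0.214` and every `H` (Burnol floor over the tree's 29 certified zero pairs,
  `lt_const_of_eventually_nbRateBound`); `rh_of_nb_rateTail` — for ANY `C` the same tail gives RH alone.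
* `not_nb_doublingTail_of_lt_half` — REFUTED over-strengthened tail: `∀ N ≥ H, D(N²) ≤ θ·D(N)`
  (`D(N) = inf_a ∫ …`) is false for every `θ < 1/2` and every `H` (iterate against the BDBLS floor
  `D(N) ≥ C/log N`, `nbIntegrand_lowerBound_two_le`); `rh_of_nb_doublingTail` — for `θ < 1` it gives RH alone.

The two abstract iteration lemmas (`doubling_iter_false`, `tendsto_zero_of_doubling`) are stated over an
arbitrary sequence `D : ℕ → ℝ` with the three RH-free properties floor / nonneg / `≤ 2π` (resp. antitone),
so that no local definition is needed.  Inside this namespace every statement spells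
`_root_.RiemannHypothesis`.

HONEST LABEL: «SPLITTING SEARCH over kernel-typed RH-EQUIVALENCES; a splitting A ∧ B ⟹ RH is CONDITIONAL
bookkeeping unless A and B are both proved; nothing here bears on the truth of RH.»
-/

noncomputable section

-- D-0017: `Summit.<S>.<S>.…` is the designed namespace of a single-problem summit.
set_option linter.dupNamespace false

open Complex MeasureTheory Set Filter Topology
open scoped Real ENNReal

namespace Summit.RiemannHypothesis.RiemannHypothesis.Theorems.Splittings.CostumeDetectorsNbNeg

open Summit.RiemannHypothesis.RiemannHypothesis.Theses.NymanBeurling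
open Summit.RiemannHypothesis.RiemannHypothesis.Theorems

/-! ## §NB-NEG.1 — the level tail is RH for every `H` (padding; F1-free) -/

/-- nb/neg (card SPLIT-nb-neg S1, V1): the Nyman–Beurling criterion restricted to witnesses of level
`N ≥ H` is equivalent to RH for EVERY `H` — zero-padding a Dirichlet polynomial does not change it
(`nb_dirichletSum_extend`), so no finite prefix of levels is load-bearing.
[cite: BaezDuarte2003, Thm. 1.1] -/
theorem nb_levelTail_iff_rh (H : ℕ) :
    (∀ ε : ℝ, 0 < ε → ∃ N : ℕ, H ≤ N ∧ ∃ a : Fin N → ℂ,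
      ∫⁻ t : ℝ, ENNReal.ofReal (‖1 - riemannZeta (1 / 2 + t * Complex.I) *
        ∑ n : Fin N, a n * ((n : ℂ) + 1) ^ (-(1 / 2 + t * Complex.I))‖ ^ 2 / (1 / 4 + t ^ 2)) <
      ENNReal.ofReal ε) ↔ _root_.RiemannHypothesis := by
  rw [← nbThesis_iff_riemannHypothesis]
  unfold NbThesis
  constructor
  · intro h ε hε
    obtain ⟨N, -, a, ha⟩ := h ε hε
    exact ⟨N, a, ha⟩
  · intro h ε hε
    obtain ⟨N, a, ha⟩ := h ε hε
    refine ⟨max N H, le_max_right _ _, fun n ↦ if hn : (n : ℕ) < N then a ⟨n, hn⟩ else 0, ?_⟩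
    have e : ∫⁻ t : ℝ, ENNReal.ofReal (‖1 - riemannZeta (1 / 2 + t * Complex.I) *
        ∑ n : Fin (max N H), (fun n : Fin (max N H) ↦ if hn : (n : ℕ) < N then a ⟨n, hn⟩ else 0) n *
          ((n : ℂ) + 1) ^ (-(1 / 2 + t * Complex.I))‖ ^ 2 / (1 / 4 + t ^ 2)) =
        ∫⁻ t : ℝ, ENNReal.ofReal (‖1 - riemannZeta (1 / 2 + t * Complex.I) *
        ∑ n : Fin N, a n * ((n : ℂ) + 1) ^ (-(1 / 2 + t * Complex.I))‖ ^ 2 / (1 / 4 + t ^ 2)) := by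
      refine lintegral_congr fun t ↦ ?_
      rw [nb_dirichletSum_extend (le_max_left N H) a]
    rw [e]
    exact ha

/-! ## §NB-NEG.2 — explicit-constant rate tails: refuted for `C ≤ 0.214`, RH alone for every `C` -/

/-- nb/neg REFUTED tail (card SPLIT-nb-neg S2, V2): «`D(N) ≤ C/log N` for all `N ≥ H`» is FALSE for
every `C ≤ 0.214` and every `H` — the tree's Burnol floor over 29 certified zero pairs,
`lt_const_of_eventually_nbRateBound` (`2π Σ m_ρ²/|ρ|² ≥ 0.2141`). The printed conjecture has
`C₀ = 2π(2+γ-log 4π) = 0.2902`. [cite: Burnol2002, Thm. 1.3] [cite: BDBLS2000, conjecture] -/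
theorem not_nb_rateTail_of_le {C : ℝ} (hC : C ≤ 214 / 1000) (H : ℕ) :
    ¬ ∀ N : ℕ, H ≤ N → ∃ a : Fin N → ℂ,
      ∫⁻ t : ℝ, ENNReal.ofReal (‖1 - riemannZeta (1 / 2 + t * Complex.I) *
        ∑ n : Fin N, a n * ((n : ℂ) + 1) ^ (-(1 / 2 + t * Complex.I))‖ ^ 2 / (1 / 4 + t ^ 2)) ≤
      ENNReal.ofReal (C / Real.log N) := by
  intro h
  have hev := eventually_atTop.2 ⟨H, fun N hN ↦ h N hN⟩
  have := lt_const_of_eventually_nbRateBound hev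
  linarith

/-- nb/neg (card SPLIT-nb-neg S2, V3): for ANY constant `C` the rate tail beyond `H` gives RH on its own
(`C/log N → 0` feeds `NbThesis`), so for `C > 0.214` the conjunct is RH-or-STRONGER and a finite
prefix is decoration; RH ⟹ tail is the open Bettin–Conrey–Farmer question.
[cite: BettinConreyFarmer2013, §1 (open question)] -/
theorem rh_of_nb_rateTail {C : ℝ} {H : ℕ}
    (h : ∀ N : ℕ, H ≤ N → ∃ a : Fin N → ℂ,
      ∫⁻ t : ℝ, ENNReal.ofReal (‖1 - riemannZeta (1 / 2 + t * Complex.I) *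
        ∑ n : Fin N, a n * ((n : ℂ) + 1) ^ (-(1 / 2 + t * Complex.I))‖ ^ 2 / (1 / 4 + t ^ 2)) ≤
      ENNReal.ofReal (C / Real.log N)) :
    _root_.RiemannHypothesis := by
  refine nbThesis_iff_riemannHypothesis.mp fun ε hε ↦ ?_
  have ht : Tendsto (fun N : ℕ ↦ C / Real.log N) atTop (𝓝 0) :=
    tendsto_const_nhds.div_atTop (Real.tendsto_log_atTop.comp tendsto_natCast_atTop_atTop)
  obtain ⟨N, hNε, hNH⟩ := ((ht.eventually (gt_mem_nhds hε)).and (eventually_ge_atTop H)).exists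
  obtain ⟨a, ha⟩ := h N hNH
  exact ⟨N, a, ha.trans_lt ((ENNReal.ofReal_lt_ofReal_iff hε).2 hNε)⟩

/-! ## §NB-NEG.3 — doubling (self-improvement) tails: refuted for `θ < 1/2`, RH alone for `θ < 1` -/

/-- Abstract iteration lemma (no definitions): a nonnegative sequence `D ≤ 2π` with a floor
`D(N) ≥ C/log N` (`N ≥ 2`, `C > 0`) cannot satisfy `D(N²) ≤ θ D(N)` for all `N ≥ H` when `θ < 1/2`:
iterating gives `C/log N₀ ≤ 2π (2θ)^k → 0`. [folklore] -/
theorem doubling_iter_false (D : ℕ → ℝ) {C : ℝ} (hC : 0 < C)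
    (hfloor : ∀ N : ℕ, 2 ≤ N → C / Real.log N ≤ D N) (h0 : ∀ N, 0 ≤ D N)
    (h2π : ∀ N, D N ≤ 2 * π) {θ : ℝ} (hθ : θ < 1 / 2) {H : ℕ}
    (h : ∀ N : ℕ, H ≤ N → D (N ^ 2) ≤ θ * D N) : False := by
  set N₀ : ℕ := max H 2 with hN₀
  have hN₀H : H ≤ N₀ := le_max_left _ _
  have hN₀2 : 2 ≤ N₀ := le_max_right _ _
  have hlog : 0 < Real.log N₀ := Real.log_pos (by exact_mod_cast hN₀2)
  have hq : 0 < C / Real.log N₀ := div_pos hC hlog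
  have hpowH : ∀ k : ℕ, H ≤ N₀ ^ 2 ^ k := fun k ↦
    hN₀H.trans (Nat.le_self_pow (pow_ne_zero k two_ne_zero) N₀)
  have hpow2 : ∀ k : ℕ, 2 ≤ N₀ ^ 2 ^ k := fun k ↦
    hN₀2.trans (Nat.le_self_pow (pow_ne_zero k two_ne_zero) N₀)
  rcases lt_or_ge θ 0 with hθ0 | hθ0
  · have h1 := h N₀ hN₀H
    have h2 : θ * D N₀ ≤ 0 := mul_nonpos_of_nonpos_of_nonneg hθ0.le (h0 N₀)
    have h3 : C / Real.log ((N₀ ^ 2 : ℕ) : ℝ) ≤ D (N₀ ^ 2) := hfloor (N₀ ^ 2) (by simpa using hpow2 1)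
    have h4 : 0 < C / Real.log ((N₀ ^ 2 : ℕ) : ℝ) := by
      refine div_pos hC (Real.log_pos ?_)
      have : (2 : ℝ) ≤ ((N₀ ^ 2 : ℕ) : ℝ) := by exact_mod_cast (by simpa using hpow2 1)
      linarith
    linarith
  · have hiter : ∀ k : ℕ, D (N₀ ^ 2 ^ k) ≤ θ ^ k * D N₀ := by
      intro k
      induction k with
      | zero => simp
      | succ k ih =>
        have hstep := h (N₀ ^ 2 ^ k) (hpowH k)
        have e : (N₀ ^ 2 ^ k) ^ 2 = N₀ ^ 2 ^ (k + 1) := by rw [← pow_mul, ← pow_succ]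
        rw [e] at hstep
        calc D (N₀ ^ 2 ^ (k + 1)) ≤ θ * D (N₀ ^ 2 ^ k) := hstep
          _ ≤ θ * (θ ^ k * D N₀) := mul_le_mul_of_nonneg_left ih hθ0
          _ = θ ^ (k + 1) * D N₀ := by ring
    have hbound : ∀ k : ℕ, C / Real.log N₀ ≤ 2 * π * (2 * θ) ^ k := by
      intro k
      have hf := hfloor (N₀ ^ 2 ^ k) (hpow2 k)
      have hlogk : Real.log ((N₀ ^ 2 ^ k : ℕ) : ℝ) = 2 ^ k * Real.log N₀ := by
        rw [Nat.cast_pow, Real.log_pow]; push_cast; ring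
      rw [hlogk] at hf
      have h2k : (0 : ℝ) < 2 ^ k := by positivity
      have hup : D (N₀ ^ 2 ^ k) ≤ θ ^ k * (2 * π) :=
        (hiter k).trans (mul_le_mul_of_nonneg_left (h2π N₀) (pow_nonneg hθ0 k))
      have key : C / (2 ^ k * Real.log N₀) ≤ θ ^ k * (2 * π) := hf.trans hup
      have e1 : C / (2 ^ k * Real.log N₀) = (C / Real.log N₀) / 2 ^ k := by
        rw [mul_comm, ← div_div]
      rw [e1, div_le_iff₀ h2k] at key
      calc C / Real.log N₀ ≤ θ ^ k * (2 * π) * 2 ^ k := key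
        _ = 2 * π * (2 * θ) ^ k := by rw [mul_pow]; ring
    have hlim : Tendsto (fun k : ℕ ↦ 2 * π * (2 * θ) ^ k) atTop (𝓝 (2 * π * 0)) :=
      (tendsto_pow_atTop_nhds_zero_of_lt_one (by linarith) (by linarith)).const_mul _
    rw [mul_zero] at hlim
    have : C / Real.log N₀ ≤ 0 := ge_of_tendsto' hlim hbound
    linarith

/-- Abstract iteration lemma (no definitions): a nonnegative ANTITONE sequence `D ≤ 2π` with
`D(N²) ≤ θ D(N)` for all `N ≥ H`, `0 ≤ θ < 1`, tends to `0` (`D(N₀^{2^k}) ≤ 2π θ^k`). [folklore] -/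
theorem tendsto_zero_of_doubling (D : ℕ → ℝ) (hanti : Antitone D) (h0 : ∀ N, 0 ≤ D N)
    (h2π : ∀ N, D N ≤ 2 * π) {θ : ℝ} (hθ0 : 0 ≤ θ) (hθ1 : θ < 1) {H : ℕ}
    (h : ∀ N : ℕ, H ≤ N → D (N ^ 2) ≤ θ * D N) : Tendsto D atTop (𝓝 0) := by
  set N₀ : ℕ := max H 2 with hN₀
  have hN₀H : H ≤ N₀ := le_max_left _ _
  have hpowH : ∀ k : ℕ, H ≤ N₀ ^ 2 ^ k := fun k ↦
    hN₀H.trans (Nat.le_self_pow (pow_ne_zero k two_ne_zero) N₀)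
  have hiter : ∀ k : ℕ, D (N₀ ^ 2 ^ k) ≤ θ ^ k * D N₀ := by
    intro k
    induction k with
    | zero => simp
    | succ k ih =>
      have hstep := h (N₀ ^ 2 ^ k) (hpowH k)
      have e : (N₀ ^ 2 ^ k) ^ 2 = N₀ ^ 2 ^ (k + 1) := by rw [← pow_mul, ← pow_succ]
      rw [e] at hstep
      calc D (N₀ ^ 2 ^ (k + 1)) ≤ θ * D (N₀ ^ 2 ^ k) := hstep
        _ ≤ θ * (θ ^ k * D N₀) := mul_le_mul_of_nonneg_left ih hθ0
        _ = θ ^ (k + 1) * D N₀ := by ring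
  rw [Metric.tendsto_atTop]
  intro ε hε
  have hlim : Tendsto (fun k : ℕ ↦ θ ^ k * (2 * π)) atTop (𝓝 (0 * (2 * π))) :=
    (tendsto_pow_atTop_nhds_zero_of_lt_one hθ0 hθ1).mul_const _
  rw [zero_mul] at hlim
  obtain ⟨k, hk⟩ := (hlim.eventually (gt_mem_nhds hε)).exists
  refine ⟨N₀ ^ 2 ^ k, fun n hn ↦ ?_⟩
  rw [Real.dist_eq, sub_zero, abs_of_nonneg (h0 n)]
  calc D n ≤ D (N₀ ^ 2 ^ k) := hanti hn
    _ ≤ θ ^ k * D N₀ := hiter k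
    _ ≤ θ ^ k * (2 * π) := mul_le_mul_of_nonneg_left (h2π N₀) (pow_nonneg hθ0 k)
    _ < ε := hk

/-- RH-free real floor under the per-level minimum `D(N) = inf_a ∫ …`: `∃ C > 0, ∀ N ≥ 2, C/log N ≤ D(N)`
(the tree's `nbIntegrand_lowerBound_two_le`, BDBLS/Burnol, moved from `∫⁻` to the Bochner `⨅`).
[cite: Burnol2002, Thm. 1.3] -/
theorem nb_dist_floor : ∃ C : ℝ, 0 < C ∧ ∀ N : ℕ, 2 ≤ N → C / Real.log N ≤
    ⨅ a : Fin N → ℂ, ∫ t : ℝ, ‖1 - riemannZeta (1 / 2 + t * I) *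
        ∑ n : Fin N, a n * ((n : ℂ) + 1) ^ (-(1 / 2 + t * I))‖ ^ 2 / (1 / 4 + t ^ 2) := by
  obtain ⟨C, hC, h⟩ := nbIntegrand_lowerBound_two_le
  refine ⟨C, hC, fun N hN ↦ le_ciInf fun a ↦ ?_⟩
  have h1 := h N hN a
  rw [nb_lintegral_eq_ofReal_integral a] at h1
  exact (ENNReal.ofReal_le_ofReal_iff (nb_integral_nonneg a)).mp h1

/-- nb/neg REFUTED tail (card SPLIT-nb-neg S3, V4): the self-improvement tail «`D(N²) ≤ θ·D(N)` for all
`N ≥ H`», `D(N) = inf_a ∫ ‖1-ζA‖²/(1/4+t²)`, is FALSE for every `θ < 1/2` and every `H` (RH-free: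
floor `C/log N ≤ D(N) ≤ 2π` and `log N² = 2 log N`). Under the printed asymptotic `D ~ C₀/log N` the
ratio tends to `1/2`. [cite: Burnol2002, Thm. 1.3] [cite: BDBLS2000, conjecture] -/
theorem not_nb_doublingTail_of_lt_half {θ : ℝ} (hθ : θ < 1 / 2) (H : ℕ) :
    ¬ ∀ N : ℕ, H ≤ N →
      (⨅ a : Fin (N ^ 2) → ℂ, ∫ t : ℝ, ‖1 - riemannZeta (1 / 2 + t * I) *
        ∑ n : Fin (N ^ 2), a n * ((n : ℂ) + 1) ^ (-(1 / 2 + t * I))‖ ^ 2 / (1 / 4 + t ^ 2)) ≤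
      θ * (⨅ a : Fin N → ℂ, ∫ t : ℝ, ‖1 - riemannZeta (1 / 2 + t * I) *
        ∑ n : Fin N, a n * ((n : ℂ) + 1) ^ (-(1 / 2 + t * I))‖ ^ 2 / (1 / 4 + t ^ 2)) := by
  intro h
  obtain ⟨C, hC, hfloor⟩ := nb_dist_floor
  exact doubling_iter_false (fun N ↦ ⨅ a : Fin N → ℂ, ∫ t : ℝ, ‖1 - riemannZeta (1 / 2 + t * I) *
        ∑ n : Fin N, a n * ((n : ℂ) + 1) ^ (-(1 / 2 + t * I))‖ ^ 2 / (1 / 4 + t ^ 2))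
    hC hfloor (fun N ↦ nb_dist_nonneg N) (fun N ↦ nb_dist_le_two_pi N) hθ h

/-- nb/neg (card SPLIT-nb-neg S3, V5): for `θ < 1` the doubling tail beyond `H` gives RH on its own
(`θ < 1/2` is refuted outright; for `1/2 ≤ θ < 1`, `D(N₀^{2^k}) ≤ 2π θ^k → 0` and `D` antitone ⟹
`D → 0` ⟹ `NbThesis` ⟹ RH), so the conjunct is RH-or-STRONGER and a finite prefix is decoration.
[cite: BaezDuarte2003, Thm. 1.1] -/
theorem rh_of_nb_doublingTail {θ : ℝ} (hθ1 : θ < 1) {H : ℕ}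
    (h : ∀ N : ℕ, H ≤ N →
      (⨅ a : Fin (N ^ 2) → ℂ, ∫ t : ℝ, ‖1 - riemannZeta (1 / 2 + t * I) *
        ∑ n : Fin (N ^ 2), a n * ((n : ℂ) + 1) ^ (-(1 / 2 + t * I))‖ ^ 2 / (1 / 4 + t ^ 2)) ≤
      θ * (⨅ a : Fin N → ℂ, ∫ t : ℝ, ‖1 - riemannZeta (1 / 2 + t * I) *
        ∑ n : Fin N, a n * ((n : ℂ) + 1) ^ (-(1 / 2 + t * I))‖ ^ 2 / (1 / 4 + t ^ 2))) :
    _root_.RiemannHypothesis := by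
  rcases lt_or_ge θ (1 / 2) with hlt | hge
  · exact absurd h (not_nb_doublingTail_of_lt_half hlt H)
  have hθ0 : 0 ≤ θ := by linarith
  refine nbThesis_iff_riemannHypothesis.mp ?_
  rw [nbThesis_iff_tendsto]
  exact tendsto_zero_of_doubling _ nb_dist_antitone (fun N ↦ nb_dist_nonneg N)
    (fun N ↦ nb_dist_le_two_pi N) hθ0 hθ1 h

end Summit.RiemannHypothesis.RiemannHypothesis.Theorems.Splittings.CostumeDetectorsNbNeg

end
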